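/-
Origin: expansion seat `planner-pub-hodgecm-mc-axioms-1-g14-0`, handover #W219 2026-08-20T15:53:55Z md5 ccc5bb998f0a (PKG b96969f73391 → ccc5bb998f0a; 228 l.; MECHANICAL (iib-R) rewrite v3.1 of the PKG file as it stands (43 token edits; rules R1x2+RX[h₂]x41)) (`HOME/mc/pub-hodgecm-mc-axioms-1-g14/revendor/kit-r55/stage55/HodgeCM/Model/Binders/Real34BaseWedge.lean`, md5 ccc5bb998f0a, 228 lines);
landed by the gen-22 packager (p-g22) in gate run 55 REPLACES the earlier landed copy of `HodgeCM/Model/Binders/Real34BaseWedge.lean` (seat copy carried the packager Origin header of an earlier run (stripped)).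
-/
/-
Origin: speedrun cell pub-hodgecm, MODEL-CONSTRUCTION sub-cell, unit pub-hodgecm-mc-binder-1-g12 (BINDER PROVER, gen 12; row 17 `real34`:
(W-0) as EXACT MEMBERSHIP, assembled from a letter-wedge decomposition and the centre-indexed supply), seat
prover-pub-hodgecm-mc-binder-1-g12-0, 2026-08-20.  Target in PKG: HodgeCM/Model/Binders/Real34BaseWedge.lean (NEW additive leaf; imports
RUN-46 #50 `Binders/Real34BaseLetter` + RUN-47 #51 `Binders/ArchKTypeAt`).  KERNEL ONLY: 2 `Set`/`Submodule`-valued defs, theorems, 2 def-valued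
constructors of the census-T record; 0 records of published theorems, nothing cited, 0 `def … : Prop`; MODEL-N ±0; E unchanged.
Nothing here is a claim of the manuscripts under adjudication.
-/
import Summits.HodgeConjecture.HodgeCM.Model.Binders.Real34BaseLetter
import Summits.HodgeConjecture.HodgeCM.Model.Binders.ArchKTypeAt_2

/-!
# Row 17's (W-0) as exact membership: the census-T record from a letter-wedge decomposition of `ins f φ₀`

After RUN 46 (`Real34CensusSideT.ofBase`) row 17 (= glue-1's `CT`) needs, per good sextic context and per `(χ, f)`, an admissible wedge
sum with the `ϑ₃₄(χ,·)`-period of the inserted base vector `insM f φ₀`.  This leaf removes the periods altogether: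

* § 1 (generic pin `S₀`) **`letterWedgeSet S₀ hV Z₂ Z₃`** — the (34) wedges
  `tau34 (Z₂(e₀^∨) ⊗ 1_{x₂+𝔫₂𝒪̂³}) (Z₃(e₁^∨) ⊗ 1_{x₃+𝔫₃𝒪̂³}) − tau34 (Z₂(e₁^∨) ⊗ 1_{x₂+𝔫₂𝒪̂³}) (Z₃(e₀^∨) ⊗ 1_{x₃+𝔫₃𝒪̂³})`
  of two archimedean letter families `Z₂, Z₃ : W^∨ →ₗ 𝒮(X_∞)` at ALL thin cosets (finite-adelic centres `x₂, x₃`, level ideals `𝔫₂, 𝔫₃`), and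
  **`letterWedgeSet_subset_admWedgeSpan`**: they are admissible as soon as (W-0-supply) every pair of centres/levels carries archimedean
  `K`-type data `B₂ : ArchKTypeDataAt 𝕏 2 x₂ 𝔫₂`, `B₃ : ArchKTypeDataAt 𝕏 3 x₃ 𝔫₃` at a common level with families `Z₂`, `Z₃` and (AN)/(REP),
  the pair actions being LF-continuous (RUN-47 #51 `ArchKTypeDataAt.wedge_mem_admWedgeSpan_of_isPMinusKilledAlong`);
* § 2 (guarded pins) **`Real34CensusSideT.ofMem (hW) core (hmem)`** — the record from `∀ f, core.side.ins f φ₀ ∈ admWedgeSpan (SGP V c) hV`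
  (take `Ψ := insM f φ₀`; the period identity is `rfl`), and **`Real34CensusSideT.ofLetterWedges (hW) core Z₂ Z₃ (hLF₂ hLF₃) (hsupply) (hdecomp)`**
  — the record from (W-0-supply) and **(W-0-decomp)** `∀ f, core.side.ins f φ₀ ∈ span (letterWedgeSet (SGP V c) hV Z₂ Z₃)`: the inserted
  base vector is a finite ℂ-combination of letter wedges (archimedean letter identity `det z = z₀ ∧ z₁` through `isoOp`/`tau34` ⊕ the
  finite ⊠-decomposition of `f` into thin cosets, whose indicators span `FinSB` — binder-2 / binder-1 algebra, no theta function, no period).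

So row 17's residual reads: (34) core TERM ⊕ (W-0-decomp) [letter algebra] ⊕ (W-0-supply) [carch-1's `k = 2, 3` tower in the `At` currency]
⊕ `IsLFAction` of the two (34) pair actions [sinst-1, `hLF_R…`].
-/

set_option autoImplicit false

noncomputable section

open MeasureTheory NumberField MulAction IsDedekindDomain
open scoped NumberField
open scoped Matrix InnerProductSpace TensorProduct Classical

attribute [-instance] Quotient.instMeasurableSpace

namespace HodgeCM.Model

open HodgeCM HodgeCM.Universe HodgeCM.Adelic HodgeCM.Model.HypCensus
open HodgeCM.PerL34 HodgeCM.PerL34.Fock HodgeCM.PerL34.Fock.PrintDict HodgeCM.PerL34.Annihilation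
open Literature.NumberTheory.Weil1964
open Literature.NumberTheory.Automorphic (piSchwartzBruhat FinSB thinCosetTestFunₗ)
open Literature.NumberTheory.GelbartRogawski1991.UnitaryDualPair
open Literature.AlgebraicGeometry.HodgeTheory
open Literature.AlgebraicGeometry.ShimuraVarieties
open Literature.NumberTheory.Automorphic.PicardCM
open Literature.NumberTheory.Transcendental (Arapura2012_Cor_15_4_6)
open HodgeCM.Model.ThetaSpace HodgeCM.Model.ArchSideTerm HodgeCM.Model.SupplyInstance HodgeCM.Model.SupplyResidual
open NumberField.SeesawArchTorus (toAdeles printedTorusHom printedTorusHom_apply placesEquiv)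
open HodgeCM.PerL34.Fock.LocalFock NumberField.SeesawTorus NumberField.SeesawArchTorus

/-! ## 1. Letter wedges at all centres, and their admissibility from the centre-indexed supply -/

section LetterWedges

variable (hHD : exists_isReal_hodgeModel) (hI : hodgePQ_independent_of_hodgeModel)
  (h₁ : BallQuotientUniformised)  (h₃ : CMAbelianVarietyRealised)

variable {L : CMField} {ι₁ : L →+* ℂ} {V : HermSpace3 L ι₁} {c : SeesawCtx L} (S₀ : ThetaAdelicSide V c) (hV : IsAnisotropic L V.Hm)

/-- **The letter wedges of two archimedean families `Z₂`, `Z₃` at all thin cosets**: the (34) wedges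
`tau34 (Z₂(e₀^∨) ⊗ 1_{x₂+𝔫₂𝒪̂³}) (Z₃(e₁^∨) ⊗ 1_{x₃+𝔫₃𝒪̂³}) − tau34 (Z₂(e₁^∨) ⊗ 1_{x₂+𝔫₂𝒪̂³}) (Z₃(e₀^∨) ⊗ 1_{x₃+𝔫₃𝒪̂³})`, finite-adelic centres
`x₂ x₃`, level ideals `𝔫₂ 𝔫₃` (a `Set`). -/
def letterWedgeSet
    (Z₂ Z₃ : Module.Dual ℂ (thetaSpaceInputIn hHD hI h₁ h₃ S₀ hV).W →ₗ[ℂ]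
      SchwartzMap ((thetaSpaceInputIn hHD hI h₁ h₃ S₀ hV).J → mixedEmbedding.mixedSpace (thetaSpaceInputIn hHD hI h₁ h₃ S₀ hV).K) ℂ) :
    Set (piSchwartzBruhat (↥(maximalRealSubfield L)) (Fin 6)) :=
  {Ψ | ∃ (x₂ x₃ : Fin 3 → FiniteAdeleRing (𝓞 ↥(maximalRealSubfield L)) ↥(maximalRealSubfield L))
      (𝔫₂ 𝔫₃ : Ideal (𝓞 ↥(maximalRealSubfield L))),
    Ψ = tau34 V c.D (thinCosetTestFunₗ x₂ 𝔫₂ (Z₂ (LinearMap.proj 0))) (thinCosetTestFunₗ x₃ 𝔫₃ (Z₃ (LinearMap.proj 1))) -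
        tau34 V c.D (thinCosetTestFunₗ x₂ 𝔫₂ (Z₂ (LinearMap.proj 1))) (thinCosetTestFunₗ x₃ 𝔫₃ (Z₃ (LinearMap.proj 0)))}

/-- their ℂ-span. -/
def letterWedgeSpan
    (Z₂ Z₃ : Module.Dual ℂ (thetaSpaceInputIn hHD hI h₁ h₃ S₀ hV).W →ₗ[ℂ]
      SchwartzMap ((thetaSpaceInputIn hHD hI h₁ h₃ S₀ hV).J → mixedEmbedding.mixedSpace (thetaSpaceInputIn hHD hI h₁ h₃ S₀ hV).K) ℂ) :
    Submodule ℂ (piSchwartzBruhat (↥(maximalRealSubfield L)) (Fin 6)) :=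
  Submodule.span ℂ (letterWedgeSet hHD hI h₁ h₃ S₀ hV Z₂ Z₃)

/-- **(W-0-supply) ⇒ every letter wedge is admissible**: if the two (34) pair actions are LF-continuous and every pair of centres/levels
carries archimedean `K`-type data of lines `2`, `3` at a common level with the families `Z₂`, `Z₃`, (AN) and (REP) along `-i e_p` (every pair of thin cosets), then
`letterWedgeSet S₀ hV Z₂ Z₃ ⊆ admWedgeSpan S₀ hV` (RUN-47 #51). -/
theorem letterWedgeSet_subset_admWedgeSpan
    (Z₂ Z₃ : Module.Dual ℂ (thetaSpaceInputIn hHD hI h₁ h₃ S₀ hV).W →ₗ[ℂ]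
      SchwartzMap ((thetaSpaceInputIn hHD hI h₁ h₃ S₀ hV).J → mixedEmbedding.mixedSpace (thetaSpaceInputIn hHD hI h₁ h₃ S₀ hV).K) ℂ)
    (hLF₂ : ((thetaSpaceInputIn hHD hI h₁ h₃ S₀ hV).P 2).IsLFAction)
    (hLF₃ : ((thetaSpaceInputIn hHD hI h₁ h₃ S₀ hV).P 3).IsLFAction)
    (hsupply : ∀ (x₂ x₃ : Fin 3 → FiniteAdeleRing (𝓞 ↥(maximalRealSubfield L)) ↥(maximalRealSubfield L))
        (𝔫₂ 𝔫₃ : Ideal (𝓞 ↥(maximalRealSubfield L))),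
      ∃ (B₂ : ArchKTypeDataAt (thetaSpaceInputIn hHD hI h₁ h₃ S₀ hV) 2 x₂ 𝔫₂)
        (B₃ : ArchKTypeDataAt (thetaSpaceInputIn hHD hI h₁ h₃ S₀ hV) 3 x₃ 𝔫₃),
        B₃.Γ₀ = B₂.Γ₀ ∧ B₂.Φarch = Z₂ ∧ B₃.Φarch = Z₃ ∧
          B₂.IsWeaklyPDiff BallForms.expP ∧
          (∀ p : Fin 2, B₂.IsPMinusKilledAlong BallForms.expP (-Complex.I • (Pi.single p 1 : Fin 2 → ℂ))) ∧
          B₃.IsWeaklyPDiff BallForms.expP ∧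
          (∀ p : Fin 2, B₃.IsPMinusKilledAlong BallForms.expP (-Complex.I • (Pi.single p 1 : Fin 2 → ℂ)))) :
    letterWedgeSet hHD hI h₁ h₃ S₀ hV Z₂ Z₃ ⊆ admWedgeSpan hHD hI h₁ h₃ S₀ hV := by
  rintro Ψ ⟨x₂, x₃, 𝔫₂, 𝔫₃, rfl⟩
  obtain ⟨B₂, B₃, hΓ, hZ₂, hZ₃, hd₂, hk₂, hd₃, hk₃⟩ := hsupply x₂ x₃ 𝔫₂ 𝔫₃
  have key := B₂.wedge_mem_admWedgeSpan_of_isPMinusKilledAlong hHD hI h₁ h₃ S₀ hV B₃ hΓ hLF₂ hd₂ hk₂ hLF₃ hd₃ hk₃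
  subst hZ₂ hZ₃
  exact key

/-- the same for the spans. -/
theorem letterWedgeSpan_le_admWedgeSpan
    (Z₂ Z₃ : Module.Dual ℂ (thetaSpaceInputIn hHD hI h₁ h₃ S₀ hV).W →ₗ[ℂ]
      SchwartzMap ((thetaSpaceInputIn hHD hI h₁ h₃ S₀ hV).J → mixedEmbedding.mixedSpace (thetaSpaceInputIn hHD hI h₁ h₃ S₀ hV).K) ℂ)
    (hLF₂ : ((thetaSpaceInputIn hHD hI h₁ h₃ S₀ hV).P 2).IsLFAction)
    (hLF₃ : ((thetaSpaceInputIn hHD hI h₁ h₃ S₀ hV).P 3).IsLFAction)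
    (hsupply : ∀ (x₂ x₃ : Fin 3 → FiniteAdeleRing (𝓞 ↥(maximalRealSubfield L)) ↥(maximalRealSubfield L))
        (𝔫₂ 𝔫₃ : Ideal (𝓞 ↥(maximalRealSubfield L))),
      ∃ (B₂ : ArchKTypeDataAt (thetaSpaceInputIn hHD hI h₁ h₃ S₀ hV) 2 x₂ 𝔫₂)
        (B₃ : ArchKTypeDataAt (thetaSpaceInputIn hHD hI h₁ h₃ S₀ hV) 3 x₃ 𝔫₃),
        B₃.Γ₀ = B₂.Γ₀ ∧ B₂.Φarch = Z₂ ∧ B₃.Φarch = Z₃ ∧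
          B₂.IsWeaklyPDiff BallForms.expP ∧
          (∀ p : Fin 2, B₂.IsPMinusKilledAlong BallForms.expP (-Complex.I • (Pi.single p 1 : Fin 2 → ℂ))) ∧
          B₃.IsWeaklyPDiff BallForms.expP ∧
          (∀ p : Fin 2, B₃.IsPMinusKilledAlong BallForms.expP (-Complex.I • (Pi.single p 1 : Fin 2 → ℂ)))) :
    letterWedgeSpan hHD hI h₁ h₃ S₀ hV Z₂ Z₃ ≤ admWedgeSpan hHD hI h₁ h₃ S₀ hV :=
  Submodule.span_le.2 (letterWedgeSet_subset_admWedgeSpan hHD hI h₁ h₃ S₀ hV Z₂ Z₃ hLF₂ hLF₃ hsupply)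

end LetterWedges

/-! ## 2. At the guarded pins: the census-T record from membership / from a letter-wedge decomposition -/

namespace Gen12PinsP

variable
  (G : ∀ {L : CMField} {ι₁ : L →+* ℂ} (_V : HermSpace3 L ι₁) (_c : SeesawCtx L), Prop)
  (hG : ∀ {L : CMField} {ι₁ : L →+* ℂ} (V : HermSpace3 L ι₁) (c : SeesawCtx L),
    G V c → (∀ j, 0 < (ι₁ (dW c.D j)).re) ∨ ∀ j, (ι₁ (dW c.D j)).re < 0)
  (hGR : ∀ {L : CMField} {ι₁ : L →+* ℂ} (V : HermSpace3 L ι₁) (c : SeesawCtx L),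
    (cmSplittingDatum (L : Type) finProdFinEquiv (frameD V) (frameD_real V) (frameD_ne V) (dW c.D) (dW_real c.D)
      (dW_ne c.D)).CompatibleSplitting)
  (η : ∀ {L : CMField} {ι₁ : L →+* ℂ} (V : HermSpace3 L ι₁) (c : SeesawCtx L),
    CMAdelic (L : Type) (frameD V) × CMAdelic (L : Type) (dW c.D) →* ℂˣ)
  (hη : ∀ {L : CMField} {ι₁ : L →+* ℂ} (V : HermSpace3 L ι₁) (c : SeesawCtx L),
    ∀ γU ∈ CMRat (L : Type) (frameD V), ∀ γ ∈ CMRat (L : Type) (dW c.D), η V c (γU, γ) = 1)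
  (hηc : ∀ {L : CMField} {ι₁ : L →+* ℂ} (V : HermSpace3 L ι₁) (c : SeesawCtx L), Continuous fun p => ((η V c p : ℂˣ) : ℂ))
  (hGR₀ : ∀ {L : CMField} {ι₁ : L →+* ℂ} (V : HermSpace3 L ι₁) (c : SeesawCtx L),
    (cmSplittingDatum (L : Type) (e₁) (frameD V) (frameD_real V) (frameD_ne V) (lineVec (L : Type) (dW c.D 0))
      (fun _ => dW_real c.D 0) (fun _ => dW_ne c.D 0)).CompatibleSplitting)
  (hGR₁ : ∀ {L : CMField} {ι₁ : L →+* ℂ} (V : HermSpace3 L ι₁) (c : SeesawCtx L),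
    (cmSplittingDatum (L : Type) (e₁) (frameD V) (frameD_real V) (frameD_ne V) (lineVec (L : Type) (dW c.D 1))
      (fun _ => dW_real c.D 1) (fun _ => dW_ne c.D 1)).CompatibleSplitting)
  (hGR₂ : ∀ {L : CMField} {ι₁ : L →+* ℂ} (V : HermSpace3 L ι₁) (c : SeesawCtx L),
    (cmSplittingDatum (L : Type) (e₁) (frameD V) (frameD_real V) (frameD_ne V) (lineVec (L : Type) (dW' c.D 0))
      (fun _ => dW'_real c.D 0) (fun _ => dW'_ne c.D 0)).CompatibleSplitting)
  (hGR₃ : ∀ {L : CMField} {ι₁ : L →+* ℂ} (V : HermSpace3 L ι₁) (c : SeesawCtx L),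
    (cmSplittingDatum (L : Type) (e₁) (frameD V) (frameD_real V) (frameD_ne V) (lineVec (L : Type) (dW' c.D 1))
      (fun _ => dW'_real c.D 1) (fun _ => dW'_ne c.D 1)).CompatibleSplitting)
  (AG : ∀ {L : CMField} {ι₁ : L →+* ℂ} (V : HermSpace3 L ι₁) (c : SeesawCtx L), G V c → ∀ k : Fin 4,
    ArchLineInput V (lineRepD V c.D (hGR V c) (hGR₀ V c) (hGR₁ V c) (hGR₂ V c) (hGR₃ V c) (η V c) k))

variable (hHD : exists_isReal_hodgeModel) (hI : hodgePQ_independent_of_hodgeModel)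
  (h₁ : BallQuotientUniformised)  (h₃ : CMAbelianVarietyRealised)
  (h : Bool) (hA : Arapura2012_Cor_15_4_6) (μ : ∀ {L : CMField}, SeesawCtx L → Fin 4 → InfinitePlace L → ℤ)

section Context34

variable {L : CMField} {ι₁ : L →+* ℂ} (V : HermSpace3 L ι₁) (c : SeesawCtx L) (hV : IsAnisotropic L V.Hm)

/-- **`Real34CensusSideT` FROM EXACT MEMBERSHIP** ((W-0-mem)): binder-2's (34) census core and
`∀ f, core.side.ins f φ₀ ∈ admWedgeSpan (SGP V c) hV` give the record — `Ψ := insM f φ₀`, the period identity is `rfl`. -/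
def Real34CensusSideT.ofMem (hW : IsAnisotropic L c.D.gramW)
    (core : HypCoreW ((Gen12Pins.Wg @hGR @η @hη @hηc @Gen12Pins.τSyl @Gen12Pins.TSyl @Gen12Pins.hTSyl) V c) c.D.jT₃₄ (fun w => -μ c 2 w) (fun w => -μ c 3 w))
    (hmem : letI := core.decEq
      ∀ f : core.side.FinIdx,
        (core.side.ins f (printPlaces (InfinitePlace (L : Type)) core.kind core.lam core.hlam
            (pinnedVacs core.kind (fun w => -μ c 2 w) (fun w => -μ c 3 w))).φ₀ : piSchwartzBruhat (↥(maximalRealSubfield L)) (Fin 6)) ∈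
          admWedgeSpan hHD hI h₁ h₃ ((SInstance.SGP @G @hG @hGR @η @hη @hηc @hGR₀ @hGR₁ @hGR₂ @hGR₃ @AG) V c) hV) :
    Real34CensusSideT @G @hG @hGR @η @hη @hηc @hGR₀ @hGR₁ @hGR₂ @hGR₃ @AG hHD hI h₁ h₃ h hA @μ V c hV :=
  Real34CensusSideT.ofBase @G @hG @hGR @η @hη @hηc @hGR₀ @hGR₁ @hGR₂ @hGR₃ @AG hHD hI h₁ h₃ h hA @μ V c hV hW core (by
    letI := core.decEq
    intro χ f
    exact ⟨insM printFact_unitaryCompact_holds ((Gen12Pins.Wg @hGR @η @hη @hηc @Gen12Pins.τSyl @Gen12Pins.TSyl @Gen12Pins.hTSyl) V c) c.D.jT₃₄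
        core.kind core.lam core.hlam (fun w => -μ c 2 w) (fun w => -μ c 3 w) core.side f
        (printPlaces (InfinitePlace (L : Type)) core.kind core.lam core.hlam (pinnedVacs core.kind (fun w => -μ c 2 w) (fun w => -μ c 3 w))).φ₀,
      hmem f, rfl⟩)

/-- **`Real34CensusSideT` FROM A LETTER-WEDGE DECOMPOSITION** ((W-0-decomp) + (W-0-supply) + LF-continuity): binder-2's (34) census core,
two archimedean letter families `Z₂`, `Z₃` of lines `2`, `3`, LF-continuity of the two (34) pair actions of the guarded S pin,
the centre-indexed supply of archimedean `K`-type data with these families ((W-0-supply), carch-1's `k = 2, 3` tower), and the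
decomposition of every inserted base vector `core.side.ins f φ₀` as a finite ℂ-combination of the letter wedges at rational centres
((W-0-decomp): the archimedean letter identity through `isoOp`/`tau34` and the finite ⊠-decomposition of `f`). -/
def Real34CensusSideT.ofLetterWedges (hW : IsAnisotropic L c.D.gramW)
    (core : HypCoreW ((Gen12Pins.Wg @hGR @η @hη @hηc @Gen12Pins.τSyl @Gen12Pins.TSyl @Gen12Pins.hTSyl) V c) c.D.jT₃₄ (fun w => -μ c 2 w) (fun w => -μ c 3 w))
    (Z₂ Z₃ : Module.Dual ℂ (thetaSpaceInputIn hHD hI h₁ h₃ ((SInstance.SGP @G @hG @hGR @η @hη @hηc @hGR₀ @hGR₁ @hGR₂ @hGR₃ @AG) V c) hV).W →ₗ[ℂ]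
      SchwartzMap ((thetaSpaceInputIn hHD hI h₁ h₃ ((SInstance.SGP @G @hG @hGR @η @hη @hηc @hGR₀ @hGR₁ @hGR₂ @hGR₃ @AG) V c) hV).J →
        mixedEmbedding.mixedSpace (thetaSpaceInputIn hHD hI h₁ h₃ ((SInstance.SGP @G @hG @hGR @η @hη @hηc @hGR₀ @hGR₁ @hGR₂ @hGR₃ @AG) V c) hV).K) ℂ)
    (hLF₂ : ((thetaSpaceInputIn hHD hI h₁ h₃ ((SInstance.SGP @G @hG @hGR @η @hη @hηc @hGR₀ @hGR₁ @hGR₂ @hGR₃ @AG) V c) hV).P 2).IsLFAction)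
    (hLF₃ : ((thetaSpaceInputIn hHD hI h₁ h₃ ((SInstance.SGP @G @hG @hGR @η @hη @hηc @hGR₀ @hGR₁ @hGR₂ @hGR₃ @AG) V c) hV).P 3).IsLFAction)
    (hsupply : ∀ (x₂ x₃ : Fin 3 → FiniteAdeleRing (𝓞 ↥(maximalRealSubfield L)) ↥(maximalRealSubfield L))
        (𝔫₂ 𝔫₃ : Ideal (𝓞 ↥(maximalRealSubfield L))),
      ∃ (B₂ : ArchKTypeDataAt (thetaSpaceInputIn hHD hI h₁ h₃ ((SInstance.SGP @G @hG @hGR @η @hη @hηc @hGR₀ @hGR₁ @hGR₂ @hGR₃ @AG) V c) hV) 2 x₂ 𝔫₂)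
        (B₃ : ArchKTypeDataAt (thetaSpaceInputIn hHD hI h₁ h₃ ((SInstance.SGP @G @hG @hGR @η @hη @hηc @hGR₀ @hGR₁ @hGR₂ @hGR₃ @AG) V c) hV) 3 x₃ 𝔫₃),
        B₃.Γ₀ = B₂.Γ₀ ∧ B₂.Φarch = Z₂ ∧ B₃.Φarch = Z₃ ∧
          B₂.IsWeaklyPDiff BallForms.expP ∧
          (∀ p : Fin 2, B₂.IsPMinusKilledAlong BallForms.expP (-Complex.I • (Pi.single p 1 : Fin 2 → ℂ))) ∧
          B₃.IsWeaklyPDiff BallForms.expP ∧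
          (∀ p : Fin 2, B₃.IsPMinusKilledAlong BallForms.expP (-Complex.I • (Pi.single p 1 : Fin 2 → ℂ))))
    (hdecomp : letI := core.decEq
      ∀ f : core.side.FinIdx,
        (core.side.ins f (printPlaces (InfinitePlace (L : Type)) core.kind core.lam core.hlam
            (pinnedVacs core.kind (fun w => -μ c 2 w) (fun w => -μ c 3 w))).φ₀ : piSchwartzBruhat (↥(maximalRealSubfield L)) (Fin 6)) ∈
          letterWedgeSpan hHD hI h₁ h₃ ((SInstance.SGP @G @hG @hGR @η @hη @hηc @hGR₀ @hGR₁ @hGR₂ @hGR₃ @AG) V c) hV Z₂ Z₃) :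
    Real34CensusSideT @G @hG @hGR @η @hη @hηc @hGR₀ @hGR₁ @hGR₂ @hGR₃ @AG hHD hI h₁ h₃ h hA @μ V c hV :=
  Real34CensusSideT.ofMem @G @hG @hGR @η @hη @hηc @hGR₀ @hGR₁ @hGR₂ @hGR₃ @AG hHD hI h₁ h₃ h hA @μ V c hV hW core fun f =>
    letterWedgeSpan_le_admWedgeSpan hHD hI h₁ h₃ _ hV Z₂ Z₃ hLF₂ hLF₃ hsupply (hdecomp f)

end Context34

end Gen12PinsP

end HodgeCM.Model

end
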